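import Summits.CriticalPhenomena.PercolationContinuityZ3.Theorems.PercNearOneGluingNoHeavyLowerTailIncStarC5Schema
import HarnessLib

/-!
# The one-pair CHORD identity for `C5` and the increasing star from the b-EDGE CHORD LEMMA (Sahi programme, prover prim-sahi-p2 gen 41)

Support file (`--supports stmt-CriticalPhenomena-4575`, helper).  No definitions, no named facts, no sorries; standard axioms.
Memo `run/shared/lean/prim/prim-sahi/FROM-prim-sahi-p2-gen41-CHORD-AT-B.md`, `prim-sahi-p2/PROOF-E3.md` §51.

Write `C5(P; s; a; b, c) := 2P(A∩B∩C) + P(A)P(B)P(C) − P(A)P(B∩C) − 2P(B)P(A∩C)` for three events (for the star `A = {s↔a}`, `B = {s↔b}`,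
`C = {s↔c}`; `C5(a;b,c) + C5(a;c,b) = 2E₃`, `IncStar.c5_add_c5_swap`).  Along one pair `e` with `p = w e`, `P⁰ = P_{w[e↦0]}`, `P¹ = P_{w[e↦1]}`,
every `P_w(S)` is `(1−p)P⁰(S) + pP¹(S)` (`stub_oneBondDecomp_k15`), and the form satisfies the EXACT one-pair identity (law of total covariance
over the coin of `e`):

  `C5(P_w) = (1−p)·C5(P⁰) + p·C5(P¹) + p(1−p)·IC_e`,
  `IC_e := Δ(A)·[κ(P¹) − κ(P⁰)] + Δ(B)·[2Δ(A∩C) − P_w(A)·Δ(C)]`,   `Δ(S) := P¹(S) − P⁰(S)`,  `κ(Q) := Q(B∩C) − Q(B)Q(C)`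

(`c5_chord_identity`; no percolation input — a `ring` identity given the affine pencil).  Hence (`c5_nonneg_of_chordStep`): `C5(P⁰) ≥ 0`,
`C5(P¹) ≥ 0` and `IC_e ≥ 0` give `C5(P_w) ≥ 0`; `IC_e ≥ 0` says that `C5` lies ABOVE ITS CHORD along `e` at the actual weight.

**`c5_nonneg_of_midPairStep`** (schema): if for every weight, every marking and every FRACTIONAL pair `s(b,y)` at the covariance-slot
target `b` (`y ≠ b` arbitrary) the form is nonnegative granted `C5 ≥ 0` for fewer fractional pairs, then `C5 ≥ 0` on every finite weighted graph
(bookkeeping as in `IncStar.c5_nonneg_of_targetPairStep`, moving `b` instead of `a` along weight-`1` pairs; the closed-class and root-class cases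
make the form vanish identically).  **`c5_nonneg_of_midChord`**, **`incStar_of_midChord`**, **`incStarPlus_of_midChord`**: if along every fractional
pair at `b` the form lies above its chord (`(1−p)C5(P⁰) + pC5(P¹) ≤ C5(P_w)`), then the C5 family, the increasing star `E₃({s↔a},{s↔b},{s↔c}) ≥ 0`
and ISTAR⁺ hold on every finite weighted graph; `c5_nonneg_of_midEdgeIC` / `incStar_of_midEdgeIC`: the same with the hypothesis in the influence
form `IC_e ≥ 0`.

STATUS of the hypothesis (the cell's CONJECTURE BCL, p2 gen 41; nothing in this file asserts it): `IC_e ≥ 0` for every pair `e ∋ b` —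
0 violations on ≈ 10⁵ exact/float instances n ≤ 8 (all weight palettes incl. thin corners; adversarial minimisation bottoms out at 0⁺, attained
only on degenerate structural zeros), and it holds on the WHOLE pencil (`q = P⁰(A)` and `q = P¹(A)` in place of `P_w(A)`; 30 530 pencils, 0 failures),
whereas the same inequality along pairs at `a`, `c` or the root fails in ≈ 0.2–1 % of pairs (which is why no fixed edge class at the distinguished
target admits a uniform certificate: memo §2).  BCL replaces the a–unmarked Bernstein step of `IncStar.incStar_of_targetUnmarkedStep` as the single
open piece.
-/

noncomputable section

namespace Summit.CriticalPhenomena.PercolationContinuityZ3.Theorems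

namespace IncStar

open MeasureTheory Set Literature.Probability.Percolation Literature.Probability.LatticeModels EdgeInduction
open scoped Classical

variable {n : ℕ}

/-! ### The one-pair chord identity -/

/-- **The one-pair chord identity for `C5`.**  For any events `A, B, C` and any pair `e` with `p = w e`:
`C5(P_w) − (1−p)C5(P⁰) − pC5(P¹) = p(1−p)·IC_e` with `IC_e = Δ(A)(κ¹ − κ⁰) + Δ(B)(2Δ(A∩C) − P_w(A)Δ(C))` (notation of the module
docstring).  Pure algebra over the affine pencil `P_w(S) = (1−p)P⁰(S) + pP¹(S)`. [this work] -/
theorem c5_chord_identity (w : Sym2 (Fin n) → unitInterval) (e : Sym2 (Fin n)) (A B C : Set (BondConfig (Fin n))) :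
    let μ := prodBernoulli (Function.update w e 0)
    let ν := prodBernoulli (Function.update w e 1)
    (2 * (prodBernoulli w).real (A ∩ B ∩ C) + (prodBernoulli w).real A * (prodBernoulli w).real B * (prodBernoulli w).real C
        - (prodBernoulli w).real A * (prodBernoulli w).real (B ∩ C) - 2 * ((prodBernoulli w).real B * (prodBernoulli w).real (A ∩ C)))
      - (1 - (w e : ℝ)) * (2 * μ.real (A ∩ B ∩ C) + μ.real A * μ.real B * μ.real C - μ.real A * μ.real (B ∩ C) - 2 * (μ.real B * μ.real (A ∩ C)))
      - (w e : ℝ) * (2 * ν.real (A ∩ B ∩ C) + ν.real A * ν.real B * ν.real C - ν.real A * ν.real (B ∩ C) - 2 * (ν.real B * ν.real (A ∩ C))) =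
      (w e : ℝ) * (1 - (w e : ℝ)) *
        ((ν.real A - μ.real A) * ((ν.real (B ∩ C) - ν.real B * ν.real C) - (μ.real (B ∩ C) - μ.real B * μ.real C))
          + (ν.real B - μ.real B) * (2 * (ν.real (A ∩ C) - μ.real (A ∩ C)) - (prodBernoulli w).real A * (ν.real C - μ.real C))) := by
  intro μ ν
  rw [stub_oneBondDecomp_k15 n w e (A ∩ B ∩ C), stub_oneBondDecomp_k15 n w e A, stub_oneBondDecomp_k15 n w e B,
    stub_oneBondDecomp_k15 n w e C, stub_oneBondDecomp_k15 n w e (B ∩ C), stub_oneBondDecomp_k15 n w e (A ∩ C)]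
  ring

/-- **`C5 ≥ 0` from the chord step along one pair.**  If the form is nonnegative under `w[e↦0]` and `w[e↦1]` and the chord defect
`IC_e` of `c5_chord_identity` is nonnegative, then `C5(P_w) ≥ 0`. [this work] -/
theorem c5_nonneg_of_chordStep (w : Sym2 (Fin n) → unitInterval) (e : Sym2 (Fin n)) (A B C : Set (BondConfig (Fin n)))
    (h0 : let μ := prodBernoulli (Function.update w e 0)
      0 ≤ 2 * μ.real (A ∩ B ∩ C) + μ.real A * μ.real B * μ.real C - μ.real A * μ.real (B ∩ C) - 2 * (μ.real B * μ.real (A ∩ C)))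
    (h1 : let ν := prodBernoulli (Function.update w e 1)
      0 ≤ 2 * ν.real (A ∩ B ∩ C) + ν.real A * ν.real B * ν.real C - ν.real A * ν.real (B ∩ C) - 2 * (ν.real B * ν.real (A ∩ C)))
    (hIC : let μ := prodBernoulli (Function.update w e 0); let ν := prodBernoulli (Function.update w e 1)
      0 ≤ (ν.real A - μ.real A) * ((ν.real (B ∩ C) - ν.real B * ν.real C) - (μ.real (B ∩ C) - μ.real B * μ.real C))
          + (ν.real B - μ.real B) * (2 * (ν.real (A ∩ C) - μ.real (A ∩ C)) - (prodBernoulli w).real A * (ν.real C - μ.real C))) :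
    0 ≤ 2 * (prodBernoulli w).real (A ∩ B ∩ C) + (prodBernoulli w).real A * (prodBernoulli w).real B * (prodBernoulli w).real C
        - (prodBernoulli w).real A * (prodBernoulli w).real (B ∩ C) - 2 * ((prodBernoulli w).real B * (prodBernoulli w).real (A ∩ C)) := by
  have hid := c5_chord_identity w e A B C
  simp only at hid h0 h1 hIC
  have hp0 : 0 ≤ (w e : ℝ) := (w e).2.1
  have hp1 : (w e : ℝ) ≤ 1 := (w e).2.2
  have hq : 0 ≤ 1 - (w e : ℝ) := by linarith
  have t0 := mul_nonneg hq h0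
  have t1 := mul_nonneg hp0 h1
  have t2 := mul_nonneg (mul_nonneg hp0 hq) hIC
  linarith [hid, t0, t1, t2]

/-! ### Moving the covariance-slot target `b` along weight-`1` pairs -/

/-- If `w s(b,u) = 1` then `C5(P_w; s; a; b, c) = C5(P_w; s; a; u, c)`: the middle target may be moved along a sure pair. [this work] -/
theorem c5_eq_of_weight_one_mid (w : Sym2 (Fin n) → unitInterval) {b u : Fin n} (hbu : b ≠ u) (h1 : w s(b, u) = 1) (s a c : Fin n) :
    let μ := prodBernoulli w
    2 * μ.real (openConn s a ∩ openConn s b ∩ openConn s c) + μ.real (openConn s a) * μ.real (openConn s b) * μ.real (openConn s c)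
        - μ.real (openConn s a) * μ.real (openConn s b ∩ openConn s c) - 2 * (μ.real (openConn s b) * μ.real (openConn s a ∩ openConn s c)) =
      2 * μ.real (openConn s a ∩ openConn s u ∩ openConn s c) + μ.real (openConn s a) * μ.real (openConn s u) * μ.real (openConn s c)
        - μ.real (openConn s a) * μ.real (openConn s u ∩ openConn s c) - 2 * (μ.real (openConn s u) * μ.real (openConn s a ∩ openConn s c)) := by
  intro μ
  have h := openConn_ae_eq_of_weight_one w hbu h1 s
  have hB : μ.real (openConn s b) = μ.real (openConn s u) := measureReal_congr h
  have hABC : μ.real (openConn s a ∩ openConn s b ∩ openConn s c) = μ.real (openConn s a ∩ openConn s u ∩ openConn s c) :=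
    measureReal_congr ((Filter.EventuallyEq.rfl.inter h).inter Filter.EventuallyEq.rfl)
  have hBC : μ.real (openConn s b ∩ openConn s c) = μ.real (openConn s u ∩ openConn s c) :=
    measureReal_congr (h.inter Filter.EventuallyEq.rfl)
  rw [hB, hABC, hBC]

/-- Transport of the form along a walk of weight-`1` pairs starting at the middle target. [this work] -/
theorem c5_eq_of_weightOneWalk_mid (w : Sym2 (Fin n) → unitInterval) (s a c : Fin n) {b u : Fin n}
    (p : (SimpleGraph.fromRel fun x y : Fin n => w s(x, y) = 1).Walk b u) :
    let μ := prodBernoulli w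
    2 * μ.real (openConn s a ∩ openConn s b ∩ openConn s c) + μ.real (openConn s a) * μ.real (openConn s b) * μ.real (openConn s c)
        - μ.real (openConn s a) * μ.real (openConn s b ∩ openConn s c) - 2 * (μ.real (openConn s b) * μ.real (openConn s a ∩ openConn s c)) =
      2 * μ.real (openConn s a ∩ openConn s u ∩ openConn s c) + μ.real (openConn s a) * μ.real (openConn s u) * μ.real (openConn s c)
        - μ.real (openConn s a) * μ.real (openConn s u ∩ openConn s c) - 2 * (μ.real (openConn s u) * μ.real (openConn s a ∩ openConn s c)) := by
  intro μ
  induction p with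
  | nil => rfl
  | @cons x y z hxy _ ih =>
      rw [SimpleGraph.fromRel_adj] at hxy
      have h1 : w s(x, y) = 1 := by
        rcases hxy.2 with h | h
        · exact h
        · rw [Sym2.eq_swap]; exact h
      have step := c5_eq_of_weight_one_mid w hxy.1 h1 s a c
      simp only [μ] at step ih ⊢
      rw [step, ih]

/-! ### The schema at the covariance-slot target -/

/-- **THE C5 FAMILY FROM ONE STEP AT THE COVARIANCE-SLOT TARGET `b`.**  Suppose that for every weight `w`, all `s a b c` and every fractional pair
`s(b,y)` (`y ≠ b`) at the middle target — granted `C5 ≥ 0` for every weight with fewer fractional pairs and every marking — the form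
`C5(P_w; s; a; b, c)` is nonnegative.  Then it is nonnegative for every finite weighted graph and every marking. [this work] -/
theorem c5_nonneg_of_midPairStep
    (hStep : ∀ (v : Sym2 (Fin n) → unitInterval) (s a b y c : Fin n), b ≠ y → s(b, y) ∈ fracEdges v →
      (∀ v' : Sym2 (Fin n) → unitInterval, (fracEdges v').card < (fracEdges v).card → ∀ s' a' b' c' : Fin n,
          let μ := prodBernoulli v'
          0 ≤ 2 * μ.real (openConn s' a' ∩ openConn s' b' ∩ openConn s' c') + μ.real (openConn s' a') * μ.real (openConn s' b') * μ.real (openConn s' c')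
                - μ.real (openConn s' a') * μ.real (openConn s' b' ∩ openConn s' c') - 2 * (μ.real (openConn s' b') * μ.real (openConn s' a' ∩ openConn s' c'))) →
      let μ := prodBernoulli v
      0 ≤ 2 * μ.real (openConn s a ∩ openConn s b ∩ openConn s c) + μ.real (openConn s a) * μ.real (openConn s b) * μ.real (openConn s c)
            - μ.real (openConn s a) * μ.real (openConn s b ∩ openConn s c) - 2 * (μ.real (openConn s b) * μ.real (openConn s a ∩ openConn s c))) :
    ∀ (w : Sym2 (Fin n) → unitInterval) (s a b c : Fin n),
      let μ := prodBernoulli w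
      0 ≤ 2 * μ.real (openConn s a ∩ openConn s b ∩ openConn s c) + μ.real (openConn s a) * μ.real (openConn s b) * μ.real (openConn s c)
            - μ.real (openConn s a) * μ.real (openConn s b ∩ openConn s c) - 2 * (μ.real (openConn s b) * μ.real (openConn s a ∩ openConn s c)) := by
  suffices H : ∀ (k : ℕ) (v : Sym2 (Fin n) → unitInterval), (fracEdges v).card ≤ k → ∀ s a b c : Fin n,
      let μ := prodBernoulli v
      0 ≤ 2 * μ.real (openConn s a ∩ openConn s b ∩ openConn s c) + μ.real (openConn s a) * μ.real (openConn s b) * μ.real (openConn s c)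
            - μ.real (openConn s a) * μ.real (openConn s b ∩ openConn s c) - 2 * (μ.real (openConn s b) * μ.real (openConn s a ∩ openConn s c)) from
    fun w s a b c => H _ w le_rfl s a b c
  intro k
  induction k with
  | zero =>
      intro v hk s a b c
      have hv : ∀ e, v e = 0 ∨ v e = 1 := fun e => eq_zero_or_one_of_not_mem_fracEdges fun he => by
        have : 0 < (fracEdges v).card := Finset.card_pos.2 ⟨e, he⟩
        omega
      simp only
      rw [real_eq_ite_of_zeroOne v hv (openConn s a ∩ openConn s b ∩ openConn s c), real_eq_ite_of_zeroOne v hv (openConn s a),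
        real_eq_ite_of_zeroOne v hv (openConn s b), real_eq_ite_of_zeroOne v hv (openConn s c), real_eq_ite_of_zeroOne v hv (openConn s b ∩ openConn s c),
        real_eq_ite_of_zeroOne v hv (openConn s a ∩ openConn s c)]
      simp only [Set.mem_inter_iff]
      by_cases hA : {e | v e = 1} ∈ openConn s a <;> by_cases hB : {e | v e = 1} ∈ openConn s b <;>
        by_cases hC : {e | v e = 1} ∈ openConn s c <;> norm_num [hA, hB, hC]
  | succ k ih =>
      intro v hk s a b c
      have IH : ∀ v' : Sym2 (Fin n) → unitInterval, (fracEdges v').card < (fracEdges v).card → ∀ s' a' b' c' : Fin n,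
          let μ := prodBernoulli v'
          0 ≤ 2 * μ.real (openConn s' a' ∩ openConn s' b' ∩ openConn s' c') + μ.real (openConn s' a') * μ.real (openConn s' b') * μ.real (openConn s' c')
                - μ.real (openConn s' a') * μ.real (openConn s' b' ∩ openConn s' c') - 2 * (μ.real (openConn s' b') * μ.real (openConn s' a' ∩ openConn s' c')) :=
        fun v' hv' s' a' b' c' => ih v' (by omega) s' a' b' c'
      -- (0) a fractional loop is switched off
      by_cases hloop : ∃ g ∈ fracEdges v, g.IsDiag
      · obtain ⟨g, hg, hgd⟩ := hloop
        have e := c5_update_diag_zero v hgd s a b c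
        simp only at e ⊢
        rw [← e]
        exact IH _ (card_fracEdges_update_lt' v hg 0 (Or.inl rfl)) s a b c
      push Not at hloop
      -- the weight-1 graph and the class of `b`
      set W1 : SimpleGraph (Fin n) := SimpleGraph.fromRel fun x y : Fin n => v s(x, y) = 1 with hW1
      -- (i) some vertex of the class of `b` carries a fractional pair: move the middle target there and apply the step
      by_cases hfrac : ∃ u y : Fin n, W1.Reachable b u ∧ u ≠ y ∧ s(u, y) ∈ fracEdges v
      · obtain ⟨u, y, hbu, huy, hg⟩ := hfrac
        obtain ⟨p⟩ := hbu
        have e := c5_eq_of_weightOneWalk_mid v s a c p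
        simp only at e ⊢
        rw [e]
        exact hStep v s a u y c huy hg IH
      push Not at hfrac
      -- (ii) the root lies in the class of `b`: `B = univ` and the form vanishes identically
      by_cases hroot : W1.Reachable b s
      · obtain ⟨p⟩ := hroot
        have e := c5_eq_of_weightOneWalk_mid v s a c p
        simp only at e ⊢
        rw [e, v1362_openConn_self, Set.inter_univ, Set.univ_inter, probReal_univ]
        have h0 : 2 * (prodBernoulli v).real (openConn s a ∩ openConn s c) + (prodBernoulli v).real (openConn s a) * 1 * (prodBernoulli v).real (openConn s c)
            - (prodBernoulli v).real (openConn s a) * (prodBernoulli v).real (openConn s c)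
            - 2 * (1 * (prodBernoulli v).real (openConn s a ∩ openConn s c)) = 0 := by ring
        rw [h0]
      -- (iii) otherwise every pair leaving the class has weight 0, so `{s ↔ b}` is null and the form vanishes
      · have hU : ∀ u z : Fin n, u ∈ {x | W1.Reachable b x} → z ∉ {x | W1.Reachable b x} → v s(u, z) = 0 := by
          intro u z hu hz
          simp only [Set.mem_setOf_eq] at hu hz
          have huz : u ≠ z := by rintro rfl; exact hz hu
          rcases eq_zero_or_one_of_not_mem_fracEdges (hfrac u z hu huz) with h | h
          · exact h
          · exact absurd (hu.trans (SimpleGraph.Adj.reachable (by rw [hW1, SimpleGraph.fromRel_adj]; exact ⟨huz, Or.inl h⟩))) hz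
        have hs : s ∉ {x | W1.Reachable b x} := fun h => hroot h
        have h0 : (prodBernoulli v).real (openConn s b) = 0 :=
          real_openConn_eq_zero_of_closedClass v {x | W1.Reachable b x} hs (SimpleGraph.Reachable.refl b) hU
        have h1 : (prodBernoulli v).real (openConn s a ∩ openConn s b ∩ openConn s c) = 0 :=
          le_antisymm (h0 ▸ measureReal_mono (fun ω hω => hω.1.2) (measure_ne_top _ _)) measureReal_nonneg
        have h2 : (prodBernoulli v).real (openConn s b ∩ openConn s c) = 0 :=
          le_antisymm (h0 ▸ measureReal_mono (fun ω hω => hω.1) (measure_ne_top _ _)) measureReal_nonneg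
        simp only
        rw [h0, h1, h2]
        have h3 : (2 : ℝ) * 0 + (prodBernoulli v).real (openConn s a) * 0 * (prodBernoulli v).real (openConn s c)
            - (prodBernoulli v).real (openConn s a) * 0 - 2 * (0 * (prodBernoulli v).real (openConn s a ∩ openConn s c)) = 0 := by ring
        rw [h3]

/-! ### The C5 family, the increasing star and ISTAR⁺ from the b-edge chord lemma -/

/-- **C5 FROM THE b-EDGE CHORD LEMMA.**  If along every fractional pair `s(b,y)` at the covariance-slot target `b` the form lies above its chord,
`(1−p)·C5(P⁰) + p·C5(P¹) ≤ C5(P_w)` (`p = w s(b,y)`), then `C5(P_w; s; a; b, c) ≥ 0` on every finite weighted graph and every marking. [this work] -/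
theorem c5_nonneg_of_midChord
    (hChord : ∀ (v : Sym2 (Fin n) → unitInterval) (s a b y c : Fin n), b ≠ y → s(b, y) ∈ fracEdges v →
      let μ := prodBernoulli (Function.update v s(b, y) 0)
      let ν := prodBernoulli (Function.update v s(b, y) 1)
      let P := prodBernoulli v
      (1 - (v s(b, y) : ℝ)) * (2 * μ.real (openConn s a ∩ openConn s b ∩ openConn s c) + μ.real (openConn s a) * μ.real (openConn s b) * μ.real (openConn s c)
            - μ.real (openConn s a) * μ.real (openConn s b ∩ openConn s c) - 2 * (μ.real (openConn s b) * μ.real (openConn s a ∩ openConn s c)))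
        + (v s(b, y) : ℝ) * (2 * ν.real (openConn s a ∩ openConn s b ∩ openConn s c) + ν.real (openConn s a) * ν.real (openConn s b) * ν.real (openConn s c)
            - ν.real (openConn s a) * ν.real (openConn s b ∩ openConn s c) - 2 * (ν.real (openConn s b) * ν.real (openConn s a ∩ openConn s c)))
        ≤ 2 * P.real (openConn s a ∩ openConn s b ∩ openConn s c) + P.real (openConn s a) * P.real (openConn s b) * P.real (openConn s c)
            - P.real (openConn s a) * P.real (openConn s b ∩ openConn s c) - 2 * (P.real (openConn s b) * P.real (openConn s a ∩ openConn s c))) :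
    ∀ (w : Sym2 (Fin n) → unitInterval) (s a b c : Fin n),
      let μ := prodBernoulli w
      0 ≤ 2 * μ.real (openConn s a ∩ openConn s b ∩ openConn s c) + μ.real (openConn s a) * μ.real (openConn s b) * μ.real (openConn s c)
            - μ.real (openConn s a) * μ.real (openConn s b ∩ openConn s c) - 2 * (μ.real (openConn s b) * μ.real (openConn s a ∩ openConn s c)) := by
  refine c5_nonneg_of_midPairStep ?_
  intro v s a b y c hby hg IH
  have h0 := IH (Function.update v s(b, y) 0) (card_fracEdges_update_lt' v hg 0 (Or.inl rfl)) s a b c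
  have h1 := IH (Function.update v s(b, y) 1) (card_fracEdges_update_lt' v hg 1 (Or.inr rfl)) s a b c
  have hc := hChord v s a b y c hby hg
  simp only at h0 h1 hc ⊢
  have hp0 : 0 ≤ (v s(b, y) : ℝ) := (v s(b, y)).2.1
  have hp1 : (v s(b, y) : ℝ) ≤ 1 := (v s(b, y)).2.2
  have hq : 0 ≤ 1 - (v s(b, y) : ℝ) := by linarith
  have t0 := mul_nonneg hq h0
  have t1 := mul_nonneg hp0 h1
  linarith [hc, t0, t1]

/-- **C5 from the b-edge chord lemma, influence form.**  If the chord defect `IC_e` of `c5_chord_identity` is nonnegative along every fractional pair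
`e = s(b,y)` at the covariance-slot target, then `C5 ≥ 0` on every finite weighted graph and every marking. [this work] -/
theorem c5_nonneg_of_midEdgeIC
    (hIC : ∀ (v : Sym2 (Fin n) → unitInterval) (s a b y c : Fin n), b ≠ y → s(b, y) ∈ fracEdges v →
      let μ := prodBernoulli (Function.update v s(b, y) 0)
      let ν := prodBernoulli (Function.update v s(b, y) 1)
      0 ≤ (ν.real (openConn s a) - μ.real (openConn s a)) *
            ((ν.real (openConn s b ∩ openConn s c) - ν.real (openConn s b) * ν.real (openConn s c))
              - (μ.real (openConn s b ∩ openConn s c) - μ.real (openConn s b) * μ.real (openConn s c)))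
          + (ν.real (openConn s b) - μ.real (openConn s b)) *
            (2 * (ν.real (openConn s a ∩ openConn s c) - μ.real (openConn s a ∩ openConn s c))
              - (prodBernoulli v).real (openConn s a) * (ν.real (openConn s c) - μ.real (openConn s c)))) :
    ∀ (w : Sym2 (Fin n) → unitInterval) (s a b c : Fin n),
      let μ := prodBernoulli w
      0 ≤ 2 * μ.real (openConn s a ∩ openConn s b ∩ openConn s c) + μ.real (openConn s a) * μ.real (openConn s b) * μ.real (openConn s c)
            - μ.real (openConn s a) * μ.real (openConn s b ∩ openConn s c) - 2 * (μ.real (openConn s b) * μ.real (openConn s a ∩ openConn s c)) := by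
  refine c5_nonneg_of_midPairStep ?_
  intro v s a b y c hby hg IH
  have h0 := IH (Function.update v s(b, y) 0) (card_fracEdges_update_lt' v hg 0 (Or.inl rfl)) s a b c
  have h1 := IH (Function.update v s(b, y) 1) (card_fracEdges_update_lt' v hg 1 (Or.inr rfl)) s a b c
  exact c5_nonneg_of_chordStep v s(b, y) (openConn s a) (openConn s b) (openConn s c) h0 h1 (hIC v s a b y c hby hg)

/-- **THE INCREASING STAR FROM THE b-EDGE CHORD LEMMA.**  Under the hypothesis of `c5_nonneg_of_midChord`,
`E₃({s↔a},{s↔b},{s↔c}) ≥ 0` on every finite weighted graph. [this work] -/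
theorem incStar_of_midChord
    (hChord : ∀ (v : Sym2 (Fin n) → unitInterval) (s a b y c : Fin n), b ≠ y → s(b, y) ∈ fracEdges v →
      let μ := prodBernoulli (Function.update v s(b, y) 0)
      let ν := prodBernoulli (Function.update v s(b, y) 1)
      let P := prodBernoulli v
      (1 - (v s(b, y) : ℝ)) * (2 * μ.real (openConn s a ∩ openConn s b ∩ openConn s c) + μ.real (openConn s a) * μ.real (openConn s b) * μ.real (openConn s c)
            - μ.real (openConn s a) * μ.real (openConn s b ∩ openConn s c) - 2 * (μ.real (openConn s b) * μ.real (openConn s a ∩ openConn s c)))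
        + (v s(b, y) : ℝ) * (2 * ν.real (openConn s a ∩ openConn s b ∩ openConn s c) + ν.real (openConn s a) * ν.real (openConn s b) * ν.real (openConn s c)
            - ν.real (openConn s a) * ν.real (openConn s b ∩ openConn s c) - 2 * (ν.real (openConn s b) * ν.real (openConn s a ∩ openConn s c)))
        ≤ 2 * P.real (openConn s a ∩ openConn s b ∩ openConn s c) + P.real (openConn s a) * P.real (openConn s b) * P.real (openConn s c)
            - P.real (openConn s a) * P.real (openConn s b ∩ openConn s c) - 2 * (P.real (openConn s b) * P.real (openConn s a ∩ openConn s c)))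
    (w : Sym2 (Fin n) → unitInterval) (s a b c : Fin n) :
    0 ≤ sahiE3 (prodBernoulli w) (openConn s a) (openConn s b) (openConn s c) :=
  sahiE3_nonneg_of_c5 _ _ _ _ (c5_nonneg_of_midChord hChord w s a b c) (c5_nonneg_of_midChord hChord w s a c b)

/-- **ISTAR⁺ from the b-edge chord lemma**: `E₃ ≥ |P(B)P(A∩C) − P(C)P(A∩B)|` for the star events, under the same hypothesis. [this work] -/
theorem incStarPlus_of_midChord
    (hChord : ∀ (v : Sym2 (Fin n) → unitInterval) (s a b y c : Fin n), b ≠ y → s(b, y) ∈ fracEdges v →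
      let μ := prodBernoulli (Function.update v s(b, y) 0)
      let ν := prodBernoulli (Function.update v s(b, y) 1)
      let P := prodBernoulli v
      (1 - (v s(b, y) : ℝ)) * (2 * μ.real (openConn s a ∩ openConn s b ∩ openConn s c) + μ.real (openConn s a) * μ.real (openConn s b) * μ.real (openConn s c)
            - μ.real (openConn s a) * μ.real (openConn s b ∩ openConn s c) - 2 * (μ.real (openConn s b) * μ.real (openConn s a ∩ openConn s c)))
        + (v s(b, y) : ℝ) * (2 * ν.real (openConn s a ∩ openConn s b ∩ openConn s c) + ν.real (openConn s a) * ν.real (openConn s b) * ν.real (openConn s c)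
            - ν.real (openConn s a) * ν.real (openConn s b ∩ openConn s c) - 2 * (ν.real (openConn s b) * ν.real (openConn s a ∩ openConn s c)))
        ≤ 2 * P.real (openConn s a ∩ openConn s b ∩ openConn s c) + P.real (openConn s a) * P.real (openConn s b) * P.real (openConn s c)
            - P.real (openConn s a) * P.real (openConn s b ∩ openConn s c) - 2 * (P.real (openConn s b) * P.real (openConn s a ∩ openConn s c)))
    (w : Sym2 (Fin n) → unitInterval) (s a b c : Fin n) :
    |(prodBernoulli w).real (openConn s b) * (prodBernoulli w).real (openConn s a ∩ openConn s c)
        - (prodBernoulli w).real (openConn s c) * (prodBernoulli w).real (openConn s a ∩ openConn s b)|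
      ≤ sahiE3 (prodBernoulli w) (openConn s a) (openConn s b) (openConn s c) :=
  abs_le_sahiE3_of_c5 _ _ _ _ (c5_nonneg_of_midChord hChord w s a b c) (c5_nonneg_of_midChord hChord w s a c b)

/-- **The increasing star from the b-edge chord lemma, influence form** (`IC_e ≥ 0` along every fractional pair `e ∋ b`). [this work] -/
theorem incStar_of_midEdgeIC
    (hIC : ∀ (v : Sym2 (Fin n) → unitInterval) (s a b y c : Fin n), b ≠ y → s(b, y) ∈ fracEdges v →
      let μ := prodBernoulli (Function.update v s(b, y) 0)
      let ν := prodBernoulli (Function.update v s(b, y) 1)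
      0 ≤ (ν.real (openConn s a) - μ.real (openConn s a)) *
            ((ν.real (openConn s b ∩ openConn s c) - ν.real (openConn s b) * ν.real (openConn s c))
              - (μ.real (openConn s b ∩ openConn s c) - μ.real (openConn s b) * μ.real (openConn s c)))
          + (ν.real (openConn s b) - μ.real (openConn s b)) *
            (2 * (ν.real (openConn s a ∩ openConn s c) - μ.real (openConn s a ∩ openConn s c))
              - (prodBernoulli v).real (openConn s a) * (ν.real (openConn s c) - μ.real (openConn s c))))
    (w : Sym2 (Fin n) → unitInterval) (s a b c : Fin n) :
    0 ≤ sahiE3 (prodBernoulli w) (openConn s a) (openConn s b) (openConn s c) :=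
  sahiE3_nonneg_of_c5 _ _ _ _ (c5_nonneg_of_midEdgeIC hIC w s a b c) (c5_nonneg_of_midEdgeIC hIC w s a c b)

end IncStar

end Summit.CriticalPhenomena.PercolationContinuityZ3.Theorems

/-!
## Status correction (prover prim-sahi-p2 gen 41, 2026-08-29 06:3xZ) — the universal hypothesis of this file is FALSE in thin corners

The conjecture whose name appears in the hypotheses above ("BCL": the chord inequality `IC_e ≥ 0` along EVERY pair at the covariance-slot target `b`,
resp. "BCL′": along every non-root pair at `b`) was refuted by the seat's own adversarial kit search with exact re-checks (kit j324920): seven weighted graphs on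
6–8 vertices have a pair at `b` — a root–b pair, or a b–unmarked pair whose unmarked end carries a weight-`0.999999` pair to the root — with chord defect
`IC_e(actual weight)` between `−2.9·10⁻¹⁵` and `−9.6·10⁻¹¹` (against `C5 ≈ 10⁻⁴`); the random exact census (25.9 M pairs at `b`) shows none.  The theorems of this
file remain correct, and its identity / schema lemmas (`c5_chord_identity`, `c5_nonneg_of_chordStep`, `c5_nonneg_of_midPairStep[']`, `c5_eq_zero_of_rootHanging`, …)
remain the tools, but the hypotheses `hChord` / `hIC` of `incStar_of_midChord[']`, `incStar_of_midEdgeIC`, `c5_nonneg_of_midChord[']` are not satisfiable for `n ≥ 6`.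
The usable reduction is `IncStar.incStar_of_existsChord` in `…IncStarC5ExistsChord` (hypothesis: SOME fractional pair with `IC_e ≥ 0` in every weighted marking —
never violated, including the seven witnesses).  Memo `run/shared/lean/prim/prim-sahi/FROM-prim-sahi-p2-gen41-CHORD-AT-B.md`, ADDENDUM F; witnesses
`run/shared/lean/prim/prim-sahi/prim-sahi-p2/gen41/lab/BCL_thin_corner_witnesses.jsonl`.
-/
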